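import Mathlib
import HarnessLib
import Summits.NavierStokesRegularity.NavierStokesRegularity.Theorems.UnthreadedRigidityDoorUnthreadedRigidityVirialHornTwoChannelByName
import Summits.NavierStokesRegularity.NavierStokesRegularity.Theorems.UnthreadedRigidityDoorUnthreadedRigidityMixedPairOrderOne

/-!
# Route `UnthreadedRigidityDoor`, item `UnthreadedRigidity` (W2, stmt-NavierStokesRegularity-27585) — S-Q OF THE MIXED-PAIR LINE BY NAME,
# from the separable slice rung in every degree (`VirialHorn.separableOrderTwoRigidityL_holds`, LINE g11-1 «VIRIAL HORN», PLATEAU PROPAGATION)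

Prover file (W2 Lean hand ns-crc-p1 g10; `--supports stmt-NavierStokesRegularity-27585 --as helper`).

Content: ★ `MixedPair.quadShellOrderTwoRigidity_holds : MixedPair.QuadShellOrderTwoRigidity` — the support S-Q of the mixed-pair line
(`…MixedPairDefs`): an admissible quadrupole shell `curl curl (H₂(|y|)·(yᵀQy)·y)` (`Q` traceless symmetric, `H₂` virial-admissible of degree
two), left-end slice of a classical solution on `[t₀,T)` with decaying pressure, whose one-sided second threading jet at `t₀` vanishes, is an
axisymmetric slice — WITHOUT the analyticity proviso of `MixedPair.quadShellOrderTwoRigidity_of_analytic` (the slice rung now holds for every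
virial-admissible profile, plateaus included).  The `C²`-in-time hypothesis of S-Q is not used.

HONEST LABEL: a support statement about SPECIAL (separable, degree-two) slice data of hypothetical order-two-silent classical solutions; the
mixed-pair slice rung `MixedPairOrderTwoRigidity` was already closed by other bridges (`mixedPairOrderTwoRigidity_of_sliceLaws`); the crux
`UnthreadedRigidity` (27585), W2 and NS regularity remain OPEN; MODEL rung; 0 kit.
-/

-- the summit and its single sub-problem share the name (CONVENTIONS §1), as in every Theorems file
set_option linter.dupNamespace false

namespace Summit.NavierStokesRegularity.NavierStokesRegularity.Theorems.UnthreadedRigidity.MixedPair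

open Summit.NavierStokesRegularity.NavierStokesRegularity.Theorems.UnthreadedRigidity.VirialHorn (separableOrderTwoRigidityL_holds)

/-- ★ S-Q BY NAME: `QuadShellOrderTwoRigidity` holds — the separable slice rung in every degree (`separableOrderTwoRigidityL_holds`) at `l = 2`
with the solid harmonic `yᵀQy` (`isSolidHarmonic_quadHarmonic`). -/
theorem quadShellOrderTwoRigidity_holds : QuadShellOrderTwoRigidity := by
  intro t₀ T u p x₀ Q H₂ hT hsol hp _hcd hQ hH hu hj2
  exact separableOrderTwoRigidityL_holds 2 t₀ T u p x₀ (quadHarmonic Q) H₂ (by norm_num) hT hsol hp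
    (isSolidHarmonic_quadHarmonic hQ) hH hu hj2

end Summit.NavierStokesRegularity.NavierStokesRegularity.Theorems.UnthreadedRigidity.MixedPair
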